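import Mathlib
import HarnessLib
import Summits.QuantumAdvantage.QuantumAdvantage.Theorems.SyndeticDialB
import Summits.QuantumAdvantage.QuantumAdvantage.Theorems.LengthDialG

/-!
# SyndeticDial, part C/3 — census land note: §5 (the pieces and `closes` BY NAME) is ALREADY IN THE TREE inside part B (the v1 twin `Theorems.SyndeticDialB`, p819783); this part carries ONLY §5b (the link to g26) — the LENGTH-SET dial on the residual 28401 `AbsorptionDial.MassHiQuasi`
(decomp-qadv · lens-5 «finite/base range ∧ asymptotic regime ∧ bridge» · generation 27 · 2026-08-31)

TARGET (live route item, BY NAME): `Summit.QuantumAdvantage.QuantumAdvantage.Theses.AbsorptionDial.MassHiQuasi`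
(stmt-QuantumAdvantage-28401, the declared RESIDUAL of route AbsorptionDial), kernel-unfolded by the LANDED
`Theorems.LengthDial.massHiQuasi_unfold : MassHiQuasi ↔ (QuarterFloor → QuasiLoss)` (`Iff.rfl`).  Write T for it,
Q for `QuasiLoss` (∃A ∀C: every cut-degree-(log₂ n)^C u-walk strategy wins ≤ (1 − 2^{−(log₂ n)^A})·2ⁿ inputs, p ≥ 5),
X for item 28487 `NoPerfectPolyOdd`.

## THESIS (the dial).  Along WHICH SET OF LENGTHS must hardness be established?  For a reach `f : ℕ → ℕ`:
* `S_f` (`SyndPiece f`): under the quarter floor, for every prime p ≥ 5, ∃A ∀C, for all large n SOME length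
  m ∈ [n − f(n), n] is hard at scale n (all charges, degree (log₂ n)^C, value 1 − 2^{−(log₂ n)^A});
* `G_f` (`GapPiece f`): the GAP LAW of reach f — hardness of any length in [n − f(n), n] (against a polylog degree of
  our choosing) forces hardness of n at the quasi-polynomial grade;
* `closes_dial f : S_f → G_f → MassHiQuasi` (every f), `closes := closes_dial half` (reach n/2: dyadic blocks).
The dial is MONOTONE (`syndPiece_mono`, `gapPiece_anti`): lengthening the reach weakens S and strengthens G.

## §A WHAT IS PROVED HERE (0 sorry; Prop-definition-free LAWS over the tree's `HardR` / `winCount` / `ringWinU` / `HasDegF`)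
1. `winCount_window` / `hardR_of_window` / `hardR_of_prefix` — THE WINDOW LAW IN VALUE FORM: `#win_c(y)` on k+ℓ+q bits is
   the sum over the 2^k·2^q fibres of the wins of the tree's ABSORBED WINDOW STRATEGIES (`AbsorptionDial.windowAbsorb`,
   identity `ringWinU_glue3_eq_windowAbsorb`, LANDED); hence `HardR p ℓ D θ → d + 2(k+q)d + 1 ≤ D → HardR p (k+ℓ+q) d θ`:
   hardness moves UP in length at LINEAR degree cost and NO value loss (supersedes g26 `LengthDial.reach`, cost 5^s).
2. `mux` / `winCount_mux` / `hasDegF_mux` — THE EXTENSION LAW (new identity): charge-multiplexing two length-k strategies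
   along a fresh front bit gives `#win_{k+1}(c, mux y₀ y₁) = #win_k(c+1, y₀) + #win_k(c, y₁)` at degree D + 1
   (`[mux] = u₀·[y₁∘tail] + (1 − u₀)·[y₀∘tail]` in `lowDeg`); corollaries `perfect_mux`, `allPerfect_add` (all-charge
   perfect play at (k, D) ⟹ at (k+t, D+t)), `pairBound_of_hardR_succ` (losses SUB-ADDITIVE up the diagonal).
3. `gapLaw_polylog B : GapLaw p (log₂ ·)^B` and `qAt_iff_synd_polylog B : QAt p ↔ Synd p (log₂ ·)^B` — THE POLYLOG BRIDGE
   IS A THEOREM and Q IS EQUIVALENT TO ITS POLYLOG-SYNDETIC FORM (prefix k ≤ (log₂ n)^B, schedule C' = B + C + 2,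
   `prefix_schedule`); globally `gapPiece_polylog`, `syndPiece_polylog_iff B : SyndPiece (plog B) ↔ MassHiQuasi`.
4. The same on the X side: `gapLawX_polylog`, `xAt_iff_syndX_polylog`, `syndXPiece_polylog_iff B : SyndXPiece (plog B) ↔
   NoPerfectPolyOdd` (item 28487, via the LANDED `perfect_of_few_losses_prefix`), `closesX_dial`.
5. Necessity / implication web: `syndPiece_of_massHiQuasi` (T ⟹ S_f, all f), `gapPiece_of_quasiLoss` (Q ⟹ G_f, all f),
   `synd_of_qAt`, `gapLaw_of_qAt`, `qAt_of_synd_gapLaw` (S ∧ G ⟹ Q per prime).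
6. LINK TO g26 (§5b): `gapLaw_of_losslessLaw : LosslessLaw p → GapLaw p f` and `gapPiece_of_lawPiece : LawPiece → GapPiece f`
   for EVERY reach f — the g26 degree-free law bridges all gaps, because ONE hard length m at degree 3d+1 yields the
   consecutive pair (m, m+1) at degree d (`hardR_succ_of_hardR`, window law with one frozen bit) and `allLengths_of_pair`
   (LANDED) propagates a pair; `closes_law f : LawPiece → SyndPiece f → MassHiQuasi` SHARPENS g26's `closes_split`
   (its `SeedPiece` needed a consecutive PAIR of off-diagonal-hard lengths per scale; one hard length anywhere ≤ n now
   suffices: `closes_law whole`, `whole n = n`, the weakest member — `syndPiece_whole_of_syndPiece`).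

## §B THE BARRIER THIS NODE RECORDS («LengthRigidity», for HOME/…/BARRIERS harvesting)
Every PROVED transfer of walk-game value between lengths has an exchange rate LINEAR IN THE GAP: degree × (2·gap + 1)
upward (window law, §A.1; the factor 2d per frozen bit is the cost of one absorbed selector pair, `hasDegF_windowAbsorb`)
and degree + gap for easiness upward / hardness downward (extension law, §A.2).  Consequently (kernel, §A.3–4): at every
reach f ≤ polylog the length dial is EXACT — S_f ≡ T and G_f is proved — and at every reach f ≫ polylog the bridge G_f
is a law with NO MECHANISM (polylog degree cannot pay a super-polylog gap), true outright if Q is (`gapPiece_of_quasiLoss`)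
and otherwise a bet of the same type as g26's `LengthDial.LawPiece` (degree-free two-step law).  THE LENGTH AXIS IS
THEREFORE CLOSED modulo one object: a transfer of hardness across a gap at SUB-LINEAR degree cost.  No such transfer is
known for any polynomial-threshold model (Razborov–Smolensky arguments are length-uniform; restrictions cost degree
per fixed bit).  This is the precise residual of every «prove it at SOME lengths, bridge to ALL» decomposition of Q or X.

## §C TAGS (per piece; tests stated)
* `SyndPiece (plog B)` — COSTUME (≡ T, kernel `syndPiece_polylog_iff`; cited as the ONE admissible EQUIV, with the split
  at reach `half` beneath it).  `GapPiece (plog B)` — PROVED (`gapPiece_polylog`).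
* `SyndPiece half` — WEAKER · leaf IDEA-NEEDED.  T-implied (`syndPiece_of_massHiQuasi`).  Why strictly weaker: it asks
  for ONE hard length per dyadic block [n/2, n] where T asks for every length, and the only converse route is G_half
  (no mechanism, §B).  Idea needed: ANY argument producing walk-game hardness along a sparse length sequence that does
  not already prove it at all lengths (none known; candidates: lengths n = 3^j where the MOD₃ structure is cyclic-group
  exact, lengths n = p^j − 1 where 𝔽_p-Frobenius orbits are uniform — both would be new).
* `GapPiece half` — UNDECIDED · BET · leaf BARRIER (§B).  Q-implied (`gapPiece_of_quasiLoss`) AND implied by g26's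
  degree-free `LawPiece` (`gapPiece_of_lawPiece`, §5b) — so this bet is WEAKER than both; not known T-implied.  Stated
  test (finite, INSTRUMENTABLE at the census's sizes): the smallest non-vacuous instance of ANY degree-sub-linear gap law
  at p = 5, D = 2 is the g26 LawPiece table — by the random-model count (|B₂(n)| = 4, 16, 70, 222, 552, 1164, 2186, 3770
  cut functions of 𝔽₅-degree ≤ 2 on n = 1..8 bits, memo NODE-g26.md N3; |B₂(n)|^{n+1} strategies against 2^{2ⁿ} win
  patterns: ≈ 10² expected perfect strategies per charge at n = 6, ≈ 10⁻¹² at n = 7) perfect D = 2 strategies are expected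
  through n = 6 (observed: V₂(4) = V₂(5) = 1, V₂(6, diag) = 1, V₂(6, off) ≥ 61/64 unresolved) and none from n = 7, so the
  first informative instance has premise lengths (7, 8) and conclusion length 9 unless V₂(6, off) < 1 (then (6, 7) → 8, the
  g26 addendum's case) — either way EXACT optimal values at lengths 7..9 over menus of 2186 / 3770 / 6092 cut functions and
  8–10 cuts, beyond exhaustive or meet-in-the-middle optimisation (≥ 5·10¹⁰ XOR-sum evaluations per charge at n = 7 already)
  and not certifiable by local search.  RECOMMENDATION to census/critic: the kit ask «lenlaw-d2»
  (STATUS l.1694) cannot return an informative row at feasible sizes and should be withdrawn or re-scoped to the two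
  INSTRUMENTABLE predictions of §A.2: (i) diagonal sub-additivity `W(k+1, D+1, c) ≥ W(k, D, c+1) + W(k, D, c)` — checked
  here by hand against the g26 tables D = 0 → 1 → 2, n ≤ 7 (e.g. n = 6 → 7: 43 + 43 = 86 ≤ 97 (diag), 44 + 43 = 87 ≤ 102
  (off); D = 1 → 2 at 7: 53 + 53 = 106 ≤ 117): consistent, slack 11–15/128; (ii) `allPerfect_add` against lens-4's
  least-perfect-degree table d*(n) (PumpDial NODE, STATUS l.1686): d*(n + t) ≤ d*(n) + t, consistent with d*(n) ≈ ⌊(n+2)/3⌋.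
* X side: `SyndXPiece (plog B)` COSTUME (≡ X), `GapXPiece (plog B)` PROVED; `SyndXPiece half` WEAKER · IDEA-NEEDED,
  `GapXPiece half` UNDECIDED · BET · BARRIER — recorded for lens-4 (owner of X), not claimed.

## §D WHY THIS IS NOVEL (by construction vs lenses 1, 2, 3, 4, 6 and vs lens-5 g26)
No other lens varies the SET OF LENGTHS at which hardness is demanded: lens-1 (NamingDial) varies names/labels of the
residue game on DWalkThree, lens-2 (SparsityDial) the density of generic inputs at one length, lens-3 certificate / dual
families (cubic bent duals on CubicForrelation), lens-4 (UnityDial/PumpDial/ReadDial) unity relations, pumps and readers of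
ONE strategy at ONE length on X, lens-6 (CharDial/OrbitDial/FieldColumns) counters, orbits and field columns of the
character table.  The engine here — window absorption read as a VALUE-TRANSFER LAW ACROSS LENGTHS plus the new
charge-multiplexing extension identity — occurs in no other node (lens-4 uses absorption at a single length to count
losses).  Versus g26 (LengthDial, same seat): g26's law cost 5^s per s bits and could bridge only bounded gaps, so even
polylog windows needed the LawPiece bet; g27 proves the polylog bridge outright (S_plog ≡ T, kernel), moves the split to
reach n/2 where the lower piece is genuinely weaker, and identifies the residual object exactly (§B).

## §E RUNG CURRENCY.  Rung 0.  Nothing here proves Q, X or the summit; the node is a LAW + BARRIER node whose split at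
reach `half` is honest (WEAKER ∧ UNDECIDED-with-test) and whose EQUIV at polylog reach is certified in kernel.
Instrument data cited: HOME/decomp-qadv-lens-5/g26/NODE-g26.md (N3/N8 tables, |B₂(n)|, V_D(n)), crit-1 row 74v22
(num/b2class_crit.out, num/lenlaw_d1.out), lens-4 PumpDial NODE (d*(n), n = 4..21).
-/

set_option autoImplicit false
set_option linter.dupNamespace false

namespace Summit.QuantumAdvantage.QuantumAdvantage.Theorems.SyndeticDial
open Finset
open Summit.QuantumAdvantage.AdviceFreeQNC0
open Literature.Computability.MetaComplexity Literature.Computability.MetaComplexity.Smolensky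
open Summit.QuantumAdvantage.QuantumAdvantage.Theorems.LengthDial
open Summit.QuantumAdvantage.QuantumAdvantage.Theorems.AbsorptionDial

/-! ## §5b LINK TO g26: the DEGREE-FREE law `LengthDial.LosslessLaw` bridges EVERY reach (one hard length ⟹ all later lengths) -/

section Law

variable {p : ℕ} [Fact p.Prime]

/-- the length-`0` game is LOST at charge `1` by every strategy except through its single cut: the constant-`true`
strategy wins it, so `HardR p 0 D θ` forces `1 ≤ θ` (used to dispose of the degenerate window end `m = 0`). -/
theorem one_le_of_hardR_zero {D : ℕ} {θ : ℝ} (h : HardR p 0 D θ) : 1 ≤ θ := by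
  have hy : ∀ g : Fin (0 + 1), HasDegF p ((fun (_ : Fin (0 + 1)) (_ : Fin 0 → Bool) => true) g) D :=
    fun _ => RigidityLaws.hasDegF_const p true D
  have hw := h 1 (fun _ _ => true) hy
  have hc : winCount 0 1 (fun (_ : Fin (0 + 1)) (_ : Fin 0 → Bool) => true) = 1 := by
    unfold winCount; decide
  rw [hc] at hw
  simpa using hw

/-- ONE hard length `m ≥ 1` at degree `D ≥ 3d + 1` gives the NEXT length hard at degree `d`, same value (window law,
one frozen prefix bit). -/
theorem hardR_succ_of_hardR {m d D : ℕ} {θ : ℝ} (hm : 1 ≤ m) (h : HardR p m D θ) (hD : 3 * d + 1 ≤ D) :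
    HardR p (m + 1) d θ := by
  have hw := hardR_of_prefix (k := 1) (d := d) hm h (by omega)
  simpa [Nat.add_comm] using hw

/-- under the degree-free law ONE hard length propagates to ALL later lengths at a third of the degree
(`hardR_succ_of_hardR` manufactures the consecutive pair, `LengthDial.allLengths_of_pair` does the rest). -/
theorem hardR_ge_of_losslessLaw (hL : LosslessLaw p) {m d D : ℕ} {θ : ℝ} (hm : 1 ≤ m) (h : HardR p m D θ)
    (hD : 3 * d + 1 ≤ D) : ∀ n, m ≤ n → HardR p n d θ := by
  have h0 : HardR p m d θ := hardR_mono h (by omega)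
  have h1 : HardR p (m + 1) d θ := hardR_succ_of_hardR hm h hD
  intro n hn
  rcases Nat.lt_or_ge n (m + 2) with hlt | hge
  · rcases (show n = m ∨ n = m + 1 by omega) with rfl | rfl
    · exact h0
    · exact h1
  · exact allLengths_of_pair hL (offHardR_of_hardR h0) (offHardR_of_hardR h1) n hge

/-- **the degree-free law bridges EVERY reach**: `LosslessLaw p → GapLaw p f` for all `f` (`A' = A`, `C' = C + 1`,
`n ≥ 16` so that `3·L^C + 1 ≤ L^(C+1)`). -/
theorem gapLaw_of_losslessLaw (hL : LosslessLaw p) (f : ℕ → ℕ) : GapLaw p f := by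
  intro A
  refine ⟨A, fun C => ⟨C + 1, 16, fun n hn m _ hmn hm => ?_⟩⟩
  unfold HardAt at hm ⊢
  have hθ : (1 : ℝ) - 1 / (2 : ℝ) ^ ((Nat.log 2 n) ^ A) < 1 := by
    have : (0 : ℝ) < 1 / (2 : ℝ) ^ ((Nat.log 2 n) ^ A) := by positivity
    linarith
  rcases Nat.eq_zero_or_pos m with rfl | hm1
  · exact absurd (one_le_of_hardR_zero hm) (not_le.mpr hθ)
  · have hL4 : 4 ≤ Nat.log 2 n := Nat.le_log_of_pow_le one_lt_two hn
    have hD : 3 * (Nat.log 2 n) ^ C + 1 ≤ (Nat.log 2 n) ^ (C + 1) := by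
      have h1 : 1 ≤ (Nat.log 2 n) ^ C := Nat.one_le_pow _ _ (by omega)
      have : 4 * (Nat.log 2 n) ^ C ≤ (Nat.log 2 n) ^ (C + 1) := by
        rw [pow_succ, mul_comm]
        exact Nat.mul_le_mul_left _ hL4
      omega
    exact hardR_ge_of_losslessLaw hL hm1 hm hD n hmn

end Law

section LawPieces

/-- the whole range as reach: `SyndPiece whole` asks only for SOME hard length `m ≤ n` at every large scale `n`
(the weakest member of the family, `syndPiece_mono`). -/
def whole : ℕ → ℕ := fun n => n

/-- **g26 ⟹ g27**: the g26 bet `LengthDial.LawPiece` (the degree-free length law) implies the bridge at EVERY reach.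
So `GapPiece half` is WEAKER than BOTH `Q` (`gapPiece_of_quasiLoss`) and `LawPiece`. -/
theorem gapPiece_of_lawPiece (hLaw : LawPiece) (f : ℕ → ℕ) : GapPiece f :=
  fun p _ hp => gapLaw_of_losslessLaw (hLaw p hp) f

/-- **g26 sharpened**: under `LawPiece`, ONE hard length per scale ANYWHERE below `n` suffices for the residual —
`closes_law whole : LawPiece → SyndPiece whole → MassHiQuasi` replaces g26's `SeedPiece` (a CONSECUTIVE PAIR of
off-diagonal-hard lengths per scale) by a single hard length (the window law manufactures the pair). -/
theorem closes_law (f : ℕ → ℕ) (hLaw : LawPiece) (hS : SyndPiece f) :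
    Summit.QuantumAdvantage.QuantumAdvantage.Theses.AbsorptionDial.MassHiQuasi :=
  closes_dial f hS (gapPiece_of_lawPiece hLaw f)

/-- every member of the family lies between the weakest seed form and the target:
`MassHiQuasi → SyndPiece f → SyndPiece whole`. -/
theorem syndPiece_whole_of_syndPiece (f : ℕ → ℕ) (h : SyndPiece f) : SyndPiece whole := by
  intro hF p _ hp
  obtain ⟨A, hA⟩ := h hF p hp
  refine ⟨A, fun C => ?_⟩
  obtain ⟨n₀, hn₀⟩ := hA C
  refine ⟨n₀, fun n hn => ?_⟩
  obtain ⟨m, _, hmn, hm⟩ := hn₀ n hn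
  exact ⟨m, by simp [whole], hmn, hm⟩

end LawPieces

end Summit.QuantumAdvantage.QuantumAdvantage.Theorems.SyndeticDial
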